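/-
Copyright (c) 2026 the pub-hodgecm-mathlib formalisation cell (harness21).  Prover seat hodgecm-mathlib-K2E3-p18 (g0), Track B «K2-LIT» ∕ h413, unit U5Kazhdan of the line
`K2_E3_EllipticInputs`: the WILD twin of E1 row 56-B3(55-B) FILE 4-RAM (the 15W∕16W∕17W∕18W engine, mechanical layer; dealer K2E3-plan (g1) DEALS BATCH #2 default for p18).  2026-09-03.
-/
import Summits.HodgeConjecture.HodgeConjecture.Theorems.F0P3cStCharTSBorelDoubleCosetsIwahoriAtDatumRamified  -- ★ FILE 4-RAM p853593 (+ ED. 2): the tame template + its place-free `_of_involution` heads (used BY NAME); brings ★ B-3b∕B-3a bookkeeping, ★ FILE 3-RAM, ★ FILE 1-RAM, ★ B1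
import Summits.HodgeConjecture.HodgeConjecture.Theorems.K2E3BorelDoubleCosetsAtDatumWild                -- FILE 3-W (this seat): `exists_torus_mul_unipotent_of_mem_P_of_apply_apartmentEnum_of_ramified` ((T-II)(H8) at a ramified quadratic datum of any residue characteristic)
import HarnessLib

/-!
# K2_E3 road (h413 = stmt-HodgeConjecture-24833), unit U5Kazhdan — THE WILD ENGINE, mechanical layer, FILE «B3(55-B)-4-W»: BOREL DOUBLE COSETS THROUGH THE IWAHORI
# `Γ = B · Stab(e₀) ⊔ B · (τ w₀) · Stab(e₀)` and `B ∩ Stab(e) = (T ∩ Stab(A 0)) · (N ∩ Stab(e))` on the `U(Φ₃)(L⁺_v)` tree at a RAMIFIED place of ANY residue characteristic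
# (the WILD twin of ★ `F0P3cStCharTSBorelDoubleCosetsIwahoriAtDatumRamified`; Bruhat–Tits 1972 (4.4.3)–(4.4.4), §10)

Cell `pub/hodgecm-mathlib`, crux H413 = `stmt-HodgeConjecture-24833`; lane `--kind proof --supports stmt-HodgeConjecture-24833 --as helper` (THEOREMS ONLY: no definition ∕ instance ∕
notation ∕ named fact ∕ `sorry`; count-neutral).  Dealer K2E3-plan (g1) DEALS BATCH #2 (2026-09-03T22:15:20Z) «**K2E3-p18** (default `Theorems/K2E3BorelDoubleCosetsAtDatumWild.lean` +
Iwahori)», wild-engine line lead K2E3-p17 (g0); consumer: K2E3-p16's 61b-W `K2E3EPInducedTraceZeroAtDatumDischargeWild` (★ 61b-RAM's call sites «FILE 3∕4 `borelDoubleCoset_{vertex,edge}_of_neg`»).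
Sequel of FILE 3-W `K2E3BorelDoubleCosetsAtDatumWild` (the vertex package).

WHAT.  ★ FILE 4-RAM's three TAME heads `mapEdgeSet_apartmentEnum_zero_ne_one_of_mem_P_of_neg`, `exists_torus_mul_unipotent_of_mem_P_of_mapEdgeSet_eq_of_neg`, `borelDoubleCoset_edge_of_neg`
re-issued WITHOUT the tame block `(hσϖ : σϖ = −ϖ) (hres) (h2 : |2|_w = 1) (hnorm)`, conclusions VERBATIM, every other binder VERBATIM:
* §1 `mapEdgeSet_apartmentEnum_zero_ne_one_of_mem_P_of_horocycleIndex (hσ hvσ hϖ) (hX1e)` — «a Borel element moves the base edge to an edge of even horocycle index» (the `hdisj` letter),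
  PLACE-FREE: its only place-sensitive input, FILE 1-RAM (X1e) `exists_horocycleIndex_edges_of_neg`, enters as the BINDER `hX1e` (its conclusion VERBATIM) — fed at a wild place by
  K2E3-p19's dealt `K2E3HorocyclesAtDatumWild.exists_horocycleIndex_edges_of_ramified`, at a tame place by ★ (X1e) `_of_neg`, at an unramified place by ★ B-1 (X1e).
* §2 `exists_torus_mul_unipotent_of_mem_P_of_mapEdgeSet_eq_of_ramified (hσ hvσ hϖ heven hd h1d h2t) (hX1v)` — `B ∩ Stab{A m, A (m+1)} = (T ∩ Stab(𝒜)) · (N ∩ Stab{A m, A (m+1)})` at a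
  ramified quadratic datum of ANY residue characteristic: no inversion by the horocycle index (X1v) (binder `hX1v`), then FILE 3-W `…_of_apply_apartmentEnum_of_ramified` ((T-II)(H8) ★ p855217).
* §3 `borelDoubleCoset_edge_of_horocycleIndex (hσ hvσ hϖ heven hd h1d h2t) (hX1v) (hX1e) (P₀ P₁ hP₀ hP₁)` and `borelDoubleCoset_edge_of_ramificationIdx_ne_one (he) (hϖ) (hX1v) (hX1e) …` at the CM
  place — the (X3∕X4) (α)-PACKAGE at the Iwahori ∕ edge type (`ι := Fin 2`, `g := ![1, τM · w₀]`): the binders `hcover hdisj hT hdec hC` of ★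
  `Representation.finrank_intertwiningMap_smoothIndRep_eq_sum_finrank_eigen`, conclusion = ★ `borelDoubleCoset_edge_of_neg`'s VERBATIM; the datum by ★ `exists_isRamifiedQuadraticDatum_of_placesOver`.
The two `_of_involution` heads of ★ FILE 4-RAM (`mapEdgeSet_apartmentEnum_eq_self_of_forall_apply_eq_of_involution`, `mapEdgeSet_tau_weylLong_apartmentEnum_zero_of_involution`) and its ED. 2
docking one-liners `borelDoubleCoset_edge_dock_of_involution` are already place-free and used BY NAME.
HONEST LABEL: count-neutral datum helper of the wild engine (W₁ `sig_K2E3EPNormOneWild` ∕ W₂ ∕ 17W of U5Kazhdan ED. 2); h413 OPEN; HC_CM is proved only modulo the 7 printed citations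
(2 remaining named inputs hLiu418 = stmt-HodgeConjecture-24832, h413 = stmt-HodgeConjecture-24833) until rung 0 closes; nothing printed is asserted here.

## References
* [BruhatTits1972] F. Bruhat, J. Tits, *Groupes réductifs sur un corps local I*, Publ. Math. IHÉS 41 (1972), (4.4.3) (Iwasawa), (4.4.4), §10.
* [Tits1979] J. Tits, *Reductive groups over local fields*, Proc. Sympos. Pure Math. 33.1 (1979), §2.4 (the ramified quasi-split `SU₃`), §3.3.3.
* [Rogawski1990] J. D. Rogawski, *Automorphic Representations of Unitary Groups in Three Variables*, Ann. of Math. Stud. 123 (1990), §1.10 p. 9, §4.5 p. 45.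
* [Serre1980Trees] J.-P. Serre, *Trees* (1980), Ch. II §1.1, Ch. I §6.4.
* [SchneiderStuhler1997] P. Schneider, U. Stuhler, *Representation theory and sheaves on the Bruhat–Tits building*, Publ. Math. IHÉS 85 (1997), §III.4 (Lemma III.4.13).
-/

set_option autoImplicit false
-- the mandated namespace has the single-problem summit's repeated segment (`HodgeConjecture.HodgeConjecture`)
set_option linter.dupNamespace false

noncomputable section

open NumberField IsDedekindDomain
open scoped Valued WithZero Matrix MatrixGroups
open Literature.NumberTheory.Rogawski1990 Literature.NumberTheory.Automorphic Literature.NumberTheory.Automorphic.UnitaryGroup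
open Literature.NumberTheory.Automorphic.UnitaryLatticeTree Literature.NumberTheory.Automorphic.HermitianLattice
open Literature.NumberTheory.Automorphic.UnitaryThreeFourFrame

namespace Summit.HodgeConjecture.HodgeConjecture.Cruxes.H413.K2E3BorelDoubleCosetsIwahoriAtDatumWild

open Summit.HodgeConjecture.HodgeConjecture.Cruxes.H413
open Summit.HodgeConjecture.HodgeConjecture.Cruxes.H413.F0P3cStCharTSHorocyclesAtDatum
open Summit.HodgeConjecture.HodgeConjecture.Cruxes.H413.F0P3cStCharTSHorocyclesAtDatumRamified
open Summit.HodgeConjecture.HodgeConjecture.Cruxes.H413.F0P3cDyRamWildPlaceDatum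

section Iwahori

variable (L : Type) [Field L] [NumberField L] [IsCMField L] (v : HeightOneSpectrum (𝓞 ↥(maximalRealSubfield L)))
  (w : PlacesOver L v) (hw : IsCMField.complexConj L • w.1 = w.1) {ϖ : w.1.adicCompletion L}
  (eA : Gqs L v ≃ₜ* ↥(unitaryGroupOfForm (galAdicCompletionMap (L := L) (IsCMField.complexConj L) hw) ((StdForm.antidiagonal 3).over (w.1.adicCompletion L))))
  (heA : ∀ g : Gqs L v,
    ((eA g : ↥(unitaryGroupOfForm (galAdicCompletionMap (L := L) (IsCMField.complexConj L) hw) ((StdForm.antidiagonal 3).over (w.1.adicCompletion L)))) :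
        GL (Fin 3) (w.1.adicCompletion L)) =
      ((localNonsplitEquiv (IsCMField.complexConj L) (qsForm L) (IsCMField.complexConj_ne_one L) w hw g :
        ↥(unitaryGroupOfForm (galAdicCompletionMap (L := L) (IsCMField.complexConj L) hw) (placeForm (qsForm L) w.1))) : GL (Fin 3) (w.1.adicCompletion L)))
  {a : Gqs L v →* ((latticeGraph (galAdicCompletionMap (L := L) (IsCMField.complexConj L) hw) ϖ ((StdForm.antidiagonal 3).over (w.1.adicCompletion L))) ≃g
    (latticeGraph (galAdicCompletionMap (L := L) (IsCMField.complexConj L) hw) ϖ ((StdForm.antidiagonal 3).over (w.1.adicCompletion L))))}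
  (ha : ∀ g, a g = latticeGraphIso (galAdicCompletionMap (L := L) (IsCMField.complexConj L) hw) ϖ ((StdForm.antidiagonal 3).over (w.1.adicCompletion L)) (eA g))
  (A : ℤ → {M : Submodule 𝒪[(w.1.adicCompletion L)] (Fin 3 → (w.1.adicCompletion L)) //
    IsVertex (galAdicCompletionMap (L := L) (IsCMField.complexConj L) hw) ϖ ((StdForm.antidiagonal 3).over (w.1.adicCompletion L)) M})
  (hA0 : ∀ c : ℤ, (A (2 * c)).1 = latt (Matrix.diagonal ![ϖ ^ c, (1 : w.1.adicCompletion L), ϖ ^ (-c)]))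
  (hA1 : ∀ c : ℤ, (A (2 * c + 1)).1 = latt (Matrix.diagonal ![ϖ ^ (c + 1), (1 : w.1.adicCompletion L), ϖ ^ (-c)]))
  (t : ParabolicTriple (Gqs L v)) (ht : t = cmBorelTriple L 3 v)
  (τM : Gqs L v) (hτM : τM ∈ t.M) (hτA : ∀ j : ℤ, a τM (A j) = A (j + 2))

include heA ha hA0 hA1 ht in
set_option maxHeartbeats 1600000 in  -- the datum vertex∕edge types (41g-H ∕ 48-datum `whnf` wall)
/-- **A BOREL ELEMENT MOVES THE BASE EDGE TO AN EDGE OF EVEN HOROCYCLE INDEX, PLACE-FREE given the edge horocycle index** (★ FILE 4-RAM `mapEdgeSet_apartmentEnum_zero_ne_one_of_mem_P_of_neg`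
with its only place-sensitive input, FILE 1-RAM (X1e), as the binder `hX1e`; conclusion VERBATIM): for `b ∈ B(L⁺_v)`, `b · {A 0, A 1} ≠ {A 1, A 2}` (horocycle index `1`).  The `hdisj` letter of
the Iwahori package. [cite: BruhatTits1972, §10] [cite: Serre1980Trees, II.1.1] -/
theorem mapEdgeSet_apartmentEnum_zero_ne_one_of_mem_P_of_horocycleIndex
    (hσ : ∀ x, (galAdicCompletionMap (L := L) (IsCMField.complexConj L) hw) ((galAdicCompletionMap (L := L) (IsCMField.complexConj L) hw) x) = x)
    (hvσ : ∀ x, Valued.v ((galAdicCompletionMap (L := L) (IsCMField.complexConj L) hw) x) = Valued.v x) (hϖ : Valued.v ϖ = WithZero.exp (-1 : ℤ))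
    (hX1e : ∃ (idx₁ : (latticeGraph (galAdicCompletionMap (L := L) (IsCMField.complexConj L) hw) ϖ ((StdForm.antidiagonal 3).over (w.1.adicCompletion L))).edgeSet → ℤ)
      (tr₁ : (latticeGraph (galAdicCompletionMap (L := L) (IsCMField.complexConj L) hw) ϖ ((StdForm.antidiagonal 3).over (w.1.adicCompletion L))).edgeSet → Gqs L v),
      (∀ d, tr₁ d ∈ (cmBorelTriple L 3 v : ParabolicTriple (Gqs L v)).N) ∧
      (∀ d, (a (tr₁ d)).mapEdgeSet ⟨s(A (idx₁ d), A (idx₁ d + 1)), (SimpleGraph.mem_edgeSet _).2 (latticeGraph_adj_apartmentEnum_succ_of_involution hσ hvσ hϖ A hA0 hA1 (idx₁ d))⟩ = d) ∧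
      (∀ n ∈ (cmBorelTriple L 3 v : ParabolicTriple (Gqs L v)).N, ∀ d, idx₁ ((a n).mapEdgeSet d) = idx₁ d) ∧
      (∀ j : ℤ, idx₁ ⟨s(A j, A (j + 1)), (SimpleGraph.mem_edgeSet _).2 (latticeGraph_adj_apartmentEnum_succ_of_involution hσ hvσ hϖ A hA0 hA1 j)⟩ = j))
    {b : Gqs L v} (hb : b ∈ t.P) :
    (a b).mapEdgeSet ⟨s(A 0, A (0 + 1)), (SimpleGraph.mem_edgeSet _).2 (latticeGraph_adj_apartmentEnum_succ_of_involution hσ hvσ hϖ A hA0 hA1 0)⟩ ≠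
      ⟨s(A 1, A (1 + 1)), (SimpleGraph.mem_edgeSet _).2 (latticeGraph_adj_apartmentEnum_succ_of_involution hσ hvσ hϖ A hA0 hA1 1)⟩ := by
  obtain ⟨idx₁, tr₁, -, -, hidxN₁, hidxA₁⟩ := hX1e
  obtain ⟨n, hn, c₀, hbn⟩ := exists_mem_N_forall_apartmentEnum_eq_of_mem_P_of_involution L v w hw eA heA ha A hA0 hA1 t ht hσ hvσ hϖ hb
  have hn' : n ∈ (cmBorelTriple L 3 v : ParabolicTriple (Gqs L v)).N := by subst ht; exact hn
  intro h
  have key : (a n).mapEdgeSet ⟨s(A (0 + 2 * c₀), A (0 + 2 * c₀ + 1)), (SimpleGraph.mem_edgeSet _).2 (latticeGraph_adj_apartmentEnum_succ_of_involution hσ hvσ hϖ A hA0 hA1 (0 + 2 * c₀))⟩ =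
      ⟨s(A 1, A (1 + 1)), (SimpleGraph.mem_edgeSet _).2 (latticeGraph_adj_apartmentEnum_succ_of_involution hσ hvσ hϖ A hA0 hA1 1)⟩ := by
    rw [← h]
    apply Subtype.ext
    change Sym2.map (a n) s(A (0 + 2 * c₀), A (0 + 2 * c₀ + 1)) = Sym2.map (a b) s(A 0, A (0 + 1))
    rw [Sym2.map_mk, Sym2.map_mk, hbn, hbn, show (0 : ℤ) + 1 + 2 * c₀ = 0 + 2 * c₀ + 1 by ring]
  have h2 := congrArg idx₁ key
  rw [hidxN₁ n hn', hidxA₁, hidxA₁] at h2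
  omega

include heA ha hA0 hA1 ht in
set_option maxHeartbeats 1600000 in  -- as above
/-- **`B ∩ Stab{A m, A (m+1)} = (T ∩ Stab(𝒜)) · (N ∩ Stab{A m, A (m+1)})` at a ramified quadratic datum of ANY residue characteristic** (twin of ★ FILE 4-RAM
`exists_torus_mul_unipotent_of_mem_P_of_mapEdgeSet_eq_of_neg`: the horocycle index (X1v) as the binder `hX1v`, the tame block replaced by the datum letters; conclusion VERBATIM): a Borel
element fixing an apartment EDGE setwise fixes both endpoints (no inversion: the horocycle index of `b · A m` has the parity of `m`), hence (FILE 3-W `…_of_apply_apartmentEnum_of_ramified`)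
is `c · n` with `c ∈ T(L⁺_v)` fixing every apartment vertex and `n ∈ N(L⁺_v)` fixing the edge. [cite: BruhatTits1972, §10] [cite: Tits1979, §2.4] [cite: Rogawski1990, §1.10 p. 9] [cite: Serre1980Trees, II.1.1] -/
theorem exists_torus_mul_unipotent_of_mem_P_of_mapEdgeSet_eq_of_ramified
    (hσ : ∀ x, (galAdicCompletionMap (L := L) (IsCMField.complexConj L) hw) ((galAdicCompletionMap (L := L) (IsCMField.complexConj L) hw) x) = x)
    (hvσ : ∀ x, Valued.v ((galAdicCompletionMap (L := L) (IsCMField.complexConj L) hw) x) = Valued.v x) (hϖ : Valued.v ϖ = WithZero.exp (-1 : ℤ))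
    (heven : ∀ x : (w.1.adicCompletion L), (galAdicCompletionMap (L := L) (IsCMField.complexConj L) hw) x = x → x ≠ 0 → ∃ n : ℤ, Valued.v x = WithZero.exp (2 * n)) {nd nt : ℕ}
    (hd : Valued.v (ϖ - (galAdicCompletionMap (L := L) (IsCMField.complexConj L) hw) ϖ) = Valued.v ϖ ^ nd) (h1d : 1 ≤ nd) (h2t : Valued.v (2 : (w.1.adicCompletion L)) = Valued.v ϖ ^ nt)
    (hX1v : ∃ (idx : {M : Submodule 𝒪[(w.1.adicCompletion L)] (Fin 3 → (w.1.adicCompletion L)) //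
        IsVertex (galAdicCompletionMap (L := L) (IsCMField.complexConj L) hw) ϖ ((StdForm.antidiagonal 3).over (w.1.adicCompletion L)) M} → ℤ)
      (tr : {M : Submodule 𝒪[(w.1.adicCompletion L)] (Fin 3 → (w.1.adicCompletion L)) //
        IsVertex (galAdicCompletionMap (L := L) (IsCMField.complexConj L) hw) ϖ ((StdForm.antidiagonal 3).over (w.1.adicCompletion L)) M} → Gqs L v),
      (∀ x, tr x ∈ (cmBorelTriple L 3 v : ParabolicTriple (Gqs L v)).N) ∧ (∀ x, a (tr x) (A (idx x)) = x) ∧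
      (∀ n ∈ (cmBorelTriple L 3 v : ParabolicTriple (Gqs L v)).N, ∀ x, idx (a n x) = idx x) ∧ (∀ j : ℤ, idx (A j) = j))
    {b : Gqs L v} (hb : b ∈ t.P) {m : ℤ}
    (hbm : (a b).mapEdgeSet ⟨s(A m, A (m + 1)), (SimpleGraph.mem_edgeSet _).2 (latticeGraph_adj_apartmentEnum_succ_of_involution hσ hvσ hϖ A hA0 hA1 m)⟩ =
      ⟨s(A m, A (m + 1)), (SimpleGraph.mem_edgeSet _).2 (latticeGraph_adj_apartmentEnum_succ_of_involution hσ hvσ hϖ A hA0 hA1 m)⟩) :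
    ∃ c n : Gqs L v, c ∈ t.M ∧ (∀ k : ℤ, a c (A k) = A k) ∧ n ∈ t.N ∧
      (a n).mapEdgeSet ⟨s(A m, A (m + 1)), (SimpleGraph.mem_edgeSet _).2 (latticeGraph_adj_apartmentEnum_succ_of_involution hσ hvσ hϖ A hA0 hA1 m)⟩ =
        ⟨s(A m, A (m + 1)), (SimpleGraph.mem_edgeSet _).2 (latticeGraph_adj_apartmentEnum_succ_of_involution hσ hvσ hϖ A hA0 hA1 m)⟩ ∧ b = c * n := by
  obtain ⟨idx, tr, -, -, hidxN, hidxA⟩ := hX1v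
  have hval := congrArg Subtype.val hbm
  change Sym2.map (a b) s(A m, A (m + 1)) = s(A m, A (m + 1)) at hval
  rw [Sym2.map_mk, Sym2.eq_iff] at hval
  -- no inversion
  have hfix : a b (A m) = A m := by
    rcases hval with ⟨h1, -⟩ | ⟨h1, -⟩
    · exact h1
    · exfalso
      obtain ⟨n, hn, c₀, hbn⟩ := exists_mem_N_forall_apartmentEnum_eq_of_mem_P_of_involution L v w hw eA heA ha A hA0 hA1 t ht hσ hvσ hϖ hb
      have hn' : n ∈ (cmBorelTriple L 3 v : ParabolicTriple (Gqs L v)).N := by subst ht; exact hn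
      have h2 := congrArg idx ((hbn m).symm.trans h1)
      rw [hidxN n hn', hidxA, hidxA] at h2
      omega
  have hfix' : a b (A (m + 1)) = A (m + 1) := by
    rcases hval with ⟨-, h2⟩ | ⟨h1, -⟩
    · exact h2
    · exact absurd (h1.symm.trans hfix) fun h => by have := apartmentEnum_injective_of_involution hϖ A hA0 hA1 h; omega
  obtain ⟨c, n, hcM, hcA, hnN, hnA, hbcn⟩ := K2E3BorelDoubleCosetsAtDatumWild.exists_torus_mul_unipotent_of_mem_P_of_apply_apartmentEnum_of_ramified L v w hw eA heA ha A hA0 hA1 t ht hσ hvσ hϖ heven hd h1d h2t hb hfix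
  refine ⟨c, n, hcM, hcA, hnN, ?_, hbcn⟩
  have hn1 : a n (A (m + 1)) = A (m + 1) := by
    have : n = c⁻¹ * b := by rw [hbcn, inv_mul_cancel_left]
    rw [this, actionHom_mul_apply L v w hw eA ha, hfix']
    exact actionHom_inv_apply_eq L v w hw eA ha (hcA (m + 1))
  apply Subtype.ext
  change Sym2.map (a n) s(A m, A (m + 1)) = s(A m, A (m + 1))
  rw [Sym2.map_mk, hnA, hn1]

include heA ha hA0 hA1 ht hτM hτA in
set_option maxHeartbeats 3200000 in  -- the datum edge type through ★ (α)'s five binder shapes (statement `whnf` + `fin_cases` on the CM carriers; = ★ FILE 4-RAM's budget)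
/-- **(X3∕X4) THE (α) PACKAGE AT THE IWAHORI ∕ EDGE TYPE, at a ramified quadratic datum of ANY residue characteristic** (twin of ★ FILE 4-RAM `borelDoubleCoset_edge_of_neg`: tame block ↦
datum letters `(heven hd h1d h2t)` + the two horocycle-index binders `hX1v`, `hX1e`; conclusion VERBATIM = `hcover ∧ hdisj ∧ hT ∧ hdec ∧ hC`; ★ B-3a `isCompact_subgroupOf_M_inf` and ★ B-3b
`mapEdgeSet_actionHom_inv_eq ∕ _one` BY NAME) (`ι := Fin 2`, `g := ![1, τM · w₀]`, `H := B = t.P`, `K := P₁ = Stab{A 0, A 1}`): TWO Borel double cosets through the Iwahori.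
[cite: BruhatTits1972, (4.4.3)–(4.4.4) and §10] [cite: Tits1979, §2.4] [cite: Rogawski1990, §1.10 p. 9; §4.5 p. 45] [cite: SchneiderStuhler1997, §III.4] [cite: Serre1980Trees, II.1.1] -/
theorem borelDoubleCoset_edge_of_horocycleIndex
    (hσ : ∀ x, (galAdicCompletionMap (L := L) (IsCMField.complexConj L) hw) ((galAdicCompletionMap (L := L) (IsCMField.complexConj L) hw) x) = x)
    (hvσ : ∀ x, Valued.v ((galAdicCompletionMap (L := L) (IsCMField.complexConj L) hw) x) = Valued.v x) (hϖ : Valued.v ϖ = WithZero.exp (-1 : ℤ))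
    (heven : ∀ x : (w.1.adicCompletion L), (galAdicCompletionMap (L := L) (IsCMField.complexConj L) hw) x = x → x ≠ 0 → ∃ n : ℤ, Valued.v x = WithZero.exp (2 * n)) {nd nt : ℕ}
    (hd : Valued.v (ϖ - (galAdicCompletionMap (L := L) (IsCMField.complexConj L) hw) ϖ) = Valued.v ϖ ^ nd) (h1d : 1 ≤ nd) (h2t : Valued.v (2 : (w.1.adicCompletion L)) = Valued.v ϖ ^ nt)
    (hX1v : ∃ (idx : {M : Submodule 𝒪[(w.1.adicCompletion L)] (Fin 3 → (w.1.adicCompletion L)) //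
        IsVertex (galAdicCompletionMap (L := L) (IsCMField.complexConj L) hw) ϖ ((StdForm.antidiagonal 3).over (w.1.adicCompletion L)) M} → ℤ)
      (tr : {M : Submodule 𝒪[(w.1.adicCompletion L)] (Fin 3 → (w.1.adicCompletion L)) //
        IsVertex (galAdicCompletionMap (L := L) (IsCMField.complexConj L) hw) ϖ ((StdForm.antidiagonal 3).over (w.1.adicCompletion L)) M} → Gqs L v),
      (∀ x, tr x ∈ (cmBorelTriple L 3 v : ParabolicTriple (Gqs L v)).N) ∧ (∀ x, a (tr x) (A (idx x)) = x) ∧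
      (∀ n ∈ (cmBorelTriple L 3 v : ParabolicTriple (Gqs L v)).N, ∀ x, idx (a n x) = idx x) ∧ (∀ j : ℤ, idx (A j) = j))
    (hX1e : ∃ (idx₁ : (latticeGraph (galAdicCompletionMap (L := L) (IsCMField.complexConj L) hw) ϖ ((StdForm.antidiagonal 3).over (w.1.adicCompletion L))).edgeSet → ℤ)
      (tr₁ : (latticeGraph (galAdicCompletionMap (L := L) (IsCMField.complexConj L) hw) ϖ ((StdForm.antidiagonal 3).over (w.1.adicCompletion L))).edgeSet → Gqs L v),
      (∀ d, tr₁ d ∈ (cmBorelTriple L 3 v : ParabolicTriple (Gqs L v)).N) ∧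
      (∀ d, (a (tr₁ d)).mapEdgeSet ⟨s(A (idx₁ d), A (idx₁ d + 1)), (SimpleGraph.mem_edgeSet _).2 (latticeGraph_adj_apartmentEnum_succ_of_involution hσ hvσ hϖ A hA0 hA1 (idx₁ d))⟩ = d) ∧
      (∀ n ∈ (cmBorelTriple L 3 v : ParabolicTriple (Gqs L v)).N, ∀ d, idx₁ ((a n).mapEdgeSet d) = idx₁ d) ∧
      (∀ j : ℤ, idx₁ ⟨s(A j, A (j + 1)), (SimpleGraph.mem_edgeSet _).2 (latticeGraph_adj_apartmentEnum_succ_of_involution hσ hvσ hϖ A hA0 hA1 j)⟩ = j))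
    (P₀ P₁ : Subgroup (Gqs L v)) (hP₀ : ∀ g, g ∈ P₀ ↔ a g (A 0) = A 0)
    (hP₁ : ∀ g, g ∈ P₁ ↔ (a g).mapEdgeSet ⟨s(A 0, A (0 + 1)), (SimpleGraph.mem_edgeSet _).2 (latticeGraph_adj_apartmentEnum_succ_of_involution hσ hvσ hϖ A hA0 hA1 0)⟩ =
      ⟨s(A 0, A (0 + 1)), (SimpleGraph.mem_edgeSet _).2 (latticeGraph_adj_apartmentEnum_succ_of_involution hσ hvσ hϖ A hA0 hA1 0)⟩) :
    (∀ y : Gqs L v, ∃ i : Fin 2, ∃ h : ↥t.P, ∃ κ ∈ P₁,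
      y = (h : Gqs L v) * (![(1 : Gqs L v), τM * eA.symm (weylLongU (galAdicCompletionMap (L := L) (IsCMField.complexConj L) hw) rfl)] i) * κ) ∧
    (∀ i j : Fin 2, (∃ h : ↥t.P, ∃ κ ∈ P₁,
      (![(1 : Gqs L v), τM * eA.symm (weylLongU (galAdicCompletionMap (L := L) (IsCMField.complexConj L) hw) rfl)] j) =
        (h : Gqs L v) * (![(1 : Gqs L v), τM * eA.symm (weylLongU (galAdicCompletionMap (L := L) (IsCMField.complexConj L) hw) rfl)] i) * κ) → i = j) ∧
    (∀ (i : Fin 2) (y : Gqs L v),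
      y ∈ t.P ⊓ P₁.map (MulAut.conj (![(1 : Gqs L v), τM * eA.symm (weylLongU (galAdicCompletionMap (L := L) (IsCMField.complexConj L) hw) rfl)] i)).toMonoidHom ↔
        y ∈ t.P ∧ (![(1 : Gqs L v), τM * eA.symm (weylLongU (galAdicCompletionMap (L := L) (IsCMField.complexConj L) hw) rfl)] i)⁻¹ * y *
          (![(1 : Gqs L v), τM * eA.symm (weylLongU (galAdicCompletionMap (L := L) (IsCMField.complexConj L) hw) rfl)] i) ∈ P₁) ∧
    (∀ (i : Fin 2) (x : ↥(t.P ⊓ P₁.map (MulAut.conj (![(1 : Gqs L v), τM * eA.symm (weylLongU (galAdicCompletionMap (L := L) (IsCMField.complexConj L) hw) rfl)] i)).toMonoidHom)),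
      ∃ c ∈ (t.M ⊓ P₀).subgroupOf (t.P ⊓ P₁.map (MulAut.conj (![(1 : Gqs L v), τM * eA.symm (weylLongU (galAdicCompletionMap (L := L) (IsCMField.complexConj L) hw) rfl)] i)).toMonoidHom),
      ∃ n ∈ t.N.subgroupOf (t.P ⊓ P₁.map (MulAut.conj (![(1 : Gqs L v), τM * eA.symm (weylLongU (galAdicCompletionMap (L := L) (IsCMField.complexConj L) hw) rfl)] i)).toMonoidHom),
      x = c * n) ∧
    (∀ i : Fin 2, IsCompact (((t.M ⊓ P₀).subgroupOf
      (t.P ⊓ P₁.map (MulAut.conj (![(1 : Gqs L v), τM * eA.symm (weylLongU (galAdicCompletionMap (L := L) (IsCMField.complexConj L) hw) rfl)] i)).toMonoidHom) :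
        Subgroup ↥(t.P ⊓ P₁.map (MulAut.conj (![(1 : Gqs L v), τM * eA.symm (weylLongU (galAdicCompletionMap (L := L) (IsCMField.complexConj L) hw) rfl)] i)).toMonoidHom)) :
      Set ↥(t.P ⊓ P₁.map (MulAut.conj (![(1 : Gqs L v), τM * eA.symm (weylLongU (galAdicCompletionMap (L := L) (IsCMField.complexConj L) hw) rfl)] i)).toMonoidHom))) := by
  set W : Gqs L v := τM * eA.symm (weylLongU (galAdicCompletionMap (L := L) (IsCMField.complexConj L) hw) rfl) with hW
  obtain ⟨idx₁, tr₁, htrN₁, htr₁, -, -⟩ := id hX1e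
  have htrN₁' : ∀ d, tr₁ d ∈ t.N := fun d => by have h := htrN₁ d; subst ht; exact h
  -- the reflected edge and the `τM`-translates of apartment edges
  have hE1 : (a W).mapEdgeSet ⟨s(A 0, A (0 + 1)), (SimpleGraph.mem_edgeSet _).2 (latticeGraph_adj_apartmentEnum_succ_of_involution hσ hvσ hϖ A hA0 hA1 0)⟩ = ⟨s(A 1, A (1 + 1)), (SimpleGraph.mem_edgeSet _).2 (latticeGraph_adj_apartmentEnum_succ_of_involution hσ hvσ hϖ A hA0 hA1 1)⟩ :=
    mapEdgeSet_tau_weylLong_apartmentEnum_zero_of_involution L v w hw eA ha A hA0 hA1 τM hτA hσ hvσ hϖ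
  have hzpow : ∀ c j : ℤ, (a (τM ^ c)).mapEdgeSet ⟨s(A (j), A (j + 1)), (SimpleGraph.mem_edgeSet _).2 (latticeGraph_adj_apartmentEnum_succ_of_involution hσ hvσ hϖ A hA0 hA1 (j))⟩ = ⟨s(A (j + 2 * c), A (j + 2 * c + 1)), (SimpleGraph.mem_edgeSet _).2 (latticeGraph_adj_apartmentEnum_succ_of_involution hσ hvσ hϖ A hA0 hA1 (j + 2 * c))⟩ := fun c j => by
    apply Subtype.ext
    change Sym2.map (a (τM ^ c)) s(A j, A (j + 1)) = s(A (j + 2 * c), A (j + 2 * c + 1))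
    rw [Sym2.map_mk, actionHom_zpow_apartmentEnum L v w hw eA ha A τM hτA, actionHom_zpow_apartmentEnum L v w hw eA ha A τM hτA,
      show j + 1 + 2 * c = j + 2 * c + 1 by ring]
  -- an apartment edge is determined by its index (transport of the anonymous constructor along an index equation)
  have hEeq : ∀ {j j' : ℤ}, j = j' → (⟨s(A (j), A (j + 1)), (SimpleGraph.mem_edgeSet _).2 (latticeGraph_adj_apartmentEnum_succ_of_involution hσ hvσ hϖ A hA0 hA1 (j))⟩ : (latticeGraph (galAdicCompletionMap (L := L) (IsCMField.complexConj L) hw) ϖ ((StdForm.antidiagonal 3).over (w.1.adicCompletion L))).edgeSet) = ⟨s(A (j'), A (j' + 1)), (SimpleGraph.mem_edgeSet _).2 (latticeGraph_adj_apartmentEnum_succ_of_involution hσ hvσ hϖ A hA0 hA1 (j'))⟩ := by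
    rintro j j' rfl; rfl
  -- conjugated membership in `P₁` = fixing the translated base edge
  have hconj : ∀ g u : Gqs L v, g⁻¹ * u * g ∈ P₁ ↔ (a u).mapEdgeSet ((a g).mapEdgeSet ⟨s(A 0, A (0 + 1)), (SimpleGraph.mem_edgeSet _).2 (latticeGraph_adj_apartmentEnum_succ_of_involution hσ hvσ hϖ A hA0 hA1 0)⟩) = (a g).mapEdgeSet ⟨s(A 0, A (0 + 1)), (SimpleGraph.mem_edgeSet _).2 (latticeGraph_adj_apartmentEnum_succ_of_involution hσ hvσ hϖ A hA0 hA1 0)⟩ := by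
    intro g u
    rw [hP₁]
    constructor
    · intro h
      have h' := congrArg ((a g).mapEdgeSet) h
      rwa [← mapEdgeSet_actionHom_mul L v w hw eA ha, show g * (g⁻¹ * u * g) = u * g by group, mapEdgeSet_actionHom_mul L v w hw eA ha] at h'
    · intro h
      rw [mapEdgeSet_actionHom_mul L v w hw eA ha, mapEdgeSet_actionHom_mul L v w hw eA ha, h]
      exact mapEdgeSet_actionHom_inv_eq L v w hw eA ha rfl
  refine ⟨fun y => ?_, fun i j hij => ?_, fun i y => ?_, fun i x => ?_, fun i => ?_⟩
  · -- hcover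
    set d := (a y).mapEdgeSet ⟨s(A 0, A (0 + 1)), (SimpleGraph.mem_edgeSet _).2 (latticeGraph_adj_apartmentEnum_succ_of_involution hσ hvσ hϖ A hA0 hA1 0)⟩ with hdd
    obtain ⟨c, hc | hc⟩ := Int.even_or_odd' (idx₁ d)
    · have hh : (a (tr₁ d * τM ^ c)).mapEdgeSet ⟨s(A 0, A (0 + 1)), (SimpleGraph.mem_edgeSet _).2 (latticeGraph_adj_apartmentEnum_succ_of_involution hσ hvσ hϖ A hA0 hA1 0)⟩ = d := by
        rw [mapEdgeSet_actionHom_mul L v w hw eA ha, hzpow c 0, hEeq (show (0 : ℤ) + 2 * c = idx₁ d by rw [hc, zero_add])]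
        exact htr₁ d
      refine ⟨0, ⟨tr₁ d * τM ^ c, mul_mem (t.N_le (htrN₁' d)) (t.M_le (zpow_mem hτM c))⟩, (tr₁ d * τM ^ c)⁻¹ * y, ?_, ?_⟩
      · rw [hP₁, mapEdgeSet_actionHom_mul L v w hw eA ha]
        exact mapEdgeSet_actionHom_inv_eq L v w hw eA ha hh
      · change y = (tr₁ d * τM ^ c) * (![(1 : Gqs L v), W] 0) * ((tr₁ d * τM ^ c)⁻¹ * y)
        simp only [Matrix.cons_val_zero, mul_one, mul_inv_cancel_left]
    · have hh : (a (tr₁ d * τM ^ c * W)).mapEdgeSet ⟨s(A 0, A (0 + 1)), (SimpleGraph.mem_edgeSet _).2 (latticeGraph_adj_apartmentEnum_succ_of_involution hσ hvσ hϖ A hA0 hA1 0)⟩ = d := by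
        rw [mapEdgeSet_actionHom_mul L v w hw eA ha, mapEdgeSet_actionHom_mul L v w hw eA ha, hE1, hzpow c 1,
          hEeq (show (1 : ℤ) + 2 * c = idx₁ d by rw [hc]; ring)]
        exact htr₁ d
      refine ⟨1, ⟨tr₁ d * τM ^ c, mul_mem (t.N_le (htrN₁' d)) (t.M_le (zpow_mem hτM c))⟩, (tr₁ d * τM ^ c * W)⁻¹ * y, ?_, ?_⟩
      · rw [hP₁, mapEdgeSet_actionHom_mul L v w hw eA ha]
        exact mapEdgeSet_actionHom_inv_eq L v w hw eA ha hh
      · change y = (tr₁ d * τM ^ c) * (![(1 : Gqs L v), W] 1) * ((tr₁ d * τM ^ c * W)⁻¹ * y)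
        simp only [Matrix.cons_val_one, Matrix.cons_val_zero, mul_inv_cancel_left]
  · -- hdisj
    fin_cases i <;> fin_cases j
    · rfl
    · exfalso
      obtain ⟨h, κ, hκ, hEq⟩ := hij
      simp only [Fin.zero_eta, Fin.mk_one, Matrix.cons_val_zero, Matrix.cons_val_one, mul_one] at hEq
      refine mapEdgeSet_apartmentEnum_zero_ne_one_of_mem_P_of_horocycleIndex L v w hw eA heA ha A hA0 hA1 t ht hσ hvσ hϖ hX1e h.2 ?_
      rw [← hE1, hEq, mapEdgeSet_actionHom_mul L v w hw eA ha, (hP₁ κ).1 hκ]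
    · exfalso
      obtain ⟨h, κ, hκ, hEq⟩ := hij
      simp only [Fin.zero_eta, Fin.mk_one, Matrix.cons_val_zero, Matrix.cons_val_one] at hEq
      have hW' : W = (h : Gqs L v)⁻¹ * κ⁻¹ := by
        rw [show (h : Gqs L v)⁻¹ * κ⁻¹ = (h : Gqs L v)⁻¹ * ((h : Gqs L v) * W * κ) * κ⁻¹ by rw [← hEq, mul_one]]
        group
      refine mapEdgeSet_apartmentEnum_zero_ne_one_of_mem_P_of_horocycleIndex L v w hw eA heA ha A hA0 hA1 t ht hσ hvσ hϖ hX1e (inv_mem h.2) ?_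
      rw [← hE1, hW', mapEdgeSet_actionHom_mul L v w hw eA ha, (hP₁ κ⁻¹).1 (inv_mem hκ)]
    · rfl
  · -- hT
    rw [Subgroup.mem_inf, Subgroup.mem_map_equiv, MulAut.conj_symm_apply]
  · -- hdec
    have hxP : (x : Gqs L v) ∈ t.P := (Subgroup.mem_inf.1 x.2).1
    have hxK := (Subgroup.mem_inf.1 x.2).2
    rw [Subgroup.mem_map_equiv, MulAut.conj_symm_apply, hconj] at hxK
    -- the translated base edge is an apartment edge `{A m, A (m+1)}`, `m = i`
    obtain ⟨m, hm⟩ : ∃ m : ℤ, (a (![(1 : Gqs L v), W] i)).mapEdgeSet ⟨s(A 0, A (0 + 1)), (SimpleGraph.mem_edgeSet _).2 (latticeGraph_adj_apartmentEnum_succ_of_involution hσ hvσ hϖ A hA0 hA1 0)⟩ = ⟨s(A (m), A (m + 1)), (SimpleGraph.mem_edgeSet _).2 (latticeGraph_adj_apartmentEnum_succ_of_involution hσ hvσ hϖ A hA0 hA1 (m))⟩ := by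
      fin_cases i
      · exact ⟨0, by simp only [Fin.zero_eta, Matrix.cons_val_zero]; exact mapEdgeSet_actionHom_one L v w hw eA ha _⟩
      · exact ⟨1, by simp only [Fin.mk_one, Matrix.cons_val_one]; exact hE1⟩
    rw [hm] at hxK
    obtain ⟨c, n, hcM, hcA, hnN, hnE, hx⟩ := exists_torus_mul_unipotent_of_mem_P_of_mapEdgeSet_eq_of_ramified L v w hw eA heA ha A hA0 hA1 t ht hσ hvσ hϖ heven hd h1d h2t hX1v hxP hxK
    have hcE : (a c).mapEdgeSet ((a (![(1 : Gqs L v), W] i)).mapEdgeSet ⟨s(A 0, A (0 + 1)), (SimpleGraph.mem_edgeSet _).2 (latticeGraph_adj_apartmentEnum_succ_of_involution hσ hvσ hϖ A hA0 hA1 0)⟩) = (a (![(1 : Gqs L v), W] i)).mapEdgeSet ⟨s(A 0, A (0 + 1)), (SimpleGraph.mem_edgeSet _).2 (latticeGraph_adj_apartmentEnum_succ_of_involution hσ hvσ hϖ A hA0 hA1 0)⟩ := by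
      rw [hm]; exact mapEdgeSet_apartmentEnum_eq_self_of_forall_apply_eq_of_involution L v w hw A hA0 hA1 hσ hvσ hϖ hcA m
    have hnE' : (a n).mapEdgeSet ((a (![(1 : Gqs L v), W] i)).mapEdgeSet ⟨s(A 0, A (0 + 1)), (SimpleGraph.mem_edgeSet _).2 (latticeGraph_adj_apartmentEnum_succ_of_involution hσ hvσ hϖ A hA0 hA1 0)⟩) = (a (![(1 : Gqs L v), W] i)).mapEdgeSet ⟨s(A 0, A (0 + 1)), (SimpleGraph.mem_edgeSet _).2 (latticeGraph_adj_apartmentEnum_succ_of_involution hσ hvσ hϖ A hA0 hA1 0)⟩ := by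
      rw [hm]; exact hnE
    refine ⟨⟨c, Subgroup.mem_inf.2 ⟨t.M_le hcM, ?_⟩⟩, Subgroup.mem_subgroupOf.2 (Subgroup.mem_inf.2 ⟨hcM, (hP₀ c).2 (hcA 0)⟩),
      ⟨n, Subgroup.mem_inf.2 ⟨t.N_le hnN, ?_⟩⟩, Subgroup.mem_subgroupOf.2 hnN, Subtype.ext hx⟩
    · rw [Subgroup.mem_map_equiv, MulAut.conj_symm_apply, hconj]; exact hcE
    · rw [Subgroup.mem_map_equiv, MulAut.conj_symm_apply, hconj]; exact hnE'
  · -- hC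
    obtain ⟨m, hm⟩ : ∃ m : ℤ, (a (![(1 : Gqs L v), W] i)).mapEdgeSet ⟨s(A 0, A (0 + 1)), (SimpleGraph.mem_edgeSet _).2 (latticeGraph_adj_apartmentEnum_succ_of_involution hσ hvσ hϖ A hA0 hA1 0)⟩ = ⟨s(A (m), A (m + 1)), (SimpleGraph.mem_edgeSet _).2 (latticeGraph_adj_apartmentEnum_succ_of_involution hσ hvσ hϖ A hA0 hA1 (m))⟩ := by
      fin_cases i
      · exact ⟨0, by simp only [Fin.zero_eta, Matrix.cons_val_zero]; exact mapEdgeSet_actionHom_one L v w hw eA ha _⟩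
      · exact ⟨1, by simp only [Fin.mk_one, Matrix.cons_val_one]; exact hE1⟩
    refine isCompact_subgroupOf_M_inf L v w hw eA heA ha t ht P₀ (A 0) hP₀ _ fun c hc => Subgroup.mem_inf.2 ⟨t.M_le (Subgroup.mem_inf.1 hc).1, ?_⟩
    have hcM : c ∈ (cmBorelTriple L 3 v : ParabolicTriple (Gqs L v)).M := by have h := (Subgroup.mem_inf.1 hc).1; subst ht; exact h
    have hcA : ∀ k : ℤ, a c (A k) = A k :=
      apartmentEnum_eq_self_of_mem_cmBorelTriple_M_of_apply_zero_of_involution L v w hw eA heA ha A hA0 hA1 hσ hvσ hϖ hcM ((hP₀ c).1 (Subgroup.mem_inf.1 hc).2)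
    rw [Subgroup.mem_map_equiv, MulAut.conj_symm_apply, hconj, hm]
    exact mapEdgeSet_apartmentEnum_eq_self_of_forall_apply_eq_of_involution L v w hw A hA0 hA1 hσ hvσ hϖ hcA m

include heA ha hA0 hA1 ht hτM hτA in
set_option maxHeartbeats 3200000 in  -- as above
/-- **(X3∕X4) THE (α) PACKAGE AT THE IWAHORI ∕ EDGE TYPE, at the CM place `w ∣ v`, RAMIFIED (`e(w∣v) ≠ 1`), any uniformiser** — the 61b-W call shape `(he) (hϖ) (hX1v) (hX1e) (P₀ P₁ hP₀ hP₁)`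
(the datum by ★ `exists_isRamifiedQuadraticDatum_of_placesOver`, K2E3-p17's 48-W∕1 convention); `hX1v ∕ hX1e` := K2E3-p19's `exists_horocycleIndex_vertices∕edges_of_ramified …`.
Conclusion VERBATIM = ★ `borelDoubleCoset_edge_of_neg`'s. [cite: BruhatTits1972, (4.4.3)–(4.4.4) and §10] [cite: Tits1979, §2.4] [cite: SchneiderStuhler1997, §III.4] -/
theorem borelDoubleCoset_edge_of_ramificationIdx_ne_one
    (hσ : ∀ x, (galAdicCompletionMap (L := L) (IsCMField.complexConj L) hw) ((galAdicCompletionMap (L := L) (IsCMField.complexConj L) hw) x) = x)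
    (hvσ : ∀ x, Valued.v ((galAdicCompletionMap (L := L) (IsCMField.complexConj L) hw) x) = Valued.v x) (hϖ : Valued.v ϖ = WithZero.exp (-1 : ℤ))
    (he : v.asIdeal.ramificationIdx' w.1.asIdeal ≠ 1)
    (hX1v : ∃ (idx : {M : Submodule 𝒪[(w.1.adicCompletion L)] (Fin 3 → (w.1.adicCompletion L)) //
        IsVertex (galAdicCompletionMap (L := L) (IsCMField.complexConj L) hw) ϖ ((StdForm.antidiagonal 3).over (w.1.adicCompletion L)) M} → ℤ)
      (tr : {M : Submodule 𝒪[(w.1.adicCompletion L)] (Fin 3 → (w.1.adicCompletion L)) //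
        IsVertex (galAdicCompletionMap (L := L) (IsCMField.complexConj L) hw) ϖ ((StdForm.antidiagonal 3).over (w.1.adicCompletion L)) M} → Gqs L v),
      (∀ x, tr x ∈ (cmBorelTriple L 3 v : ParabolicTriple (Gqs L v)).N) ∧ (∀ x, a (tr x) (A (idx x)) = x) ∧
      (∀ n ∈ (cmBorelTriple L 3 v : ParabolicTriple (Gqs L v)).N, ∀ x, idx (a n x) = idx x) ∧ (∀ j : ℤ, idx (A j) = j))
    (hX1e : ∃ (idx₁ : (latticeGraph (galAdicCompletionMap (L := L) (IsCMField.complexConj L) hw) ϖ ((StdForm.antidiagonal 3).over (w.1.adicCompletion L))).edgeSet → ℤ)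
      (tr₁ : (latticeGraph (galAdicCompletionMap (L := L) (IsCMField.complexConj L) hw) ϖ ((StdForm.antidiagonal 3).over (w.1.adicCompletion L))).edgeSet → Gqs L v),
      (∀ d, tr₁ d ∈ (cmBorelTriple L 3 v : ParabolicTriple (Gqs L v)).N) ∧
      (∀ d, (a (tr₁ d)).mapEdgeSet ⟨s(A (idx₁ d), A (idx₁ d + 1)), (SimpleGraph.mem_edgeSet _).2 (latticeGraph_adj_apartmentEnum_succ_of_involution hσ hvσ hϖ A hA0 hA1 (idx₁ d))⟩ = d) ∧
      (∀ n ∈ (cmBorelTriple L 3 v : ParabolicTriple (Gqs L v)).N, ∀ d, idx₁ ((a n).mapEdgeSet d) = idx₁ d) ∧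
      (∀ j : ℤ, idx₁ ⟨s(A j, A (j + 1)), (SimpleGraph.mem_edgeSet _).2 (latticeGraph_adj_apartmentEnum_succ_of_involution hσ hvσ hϖ A hA0 hA1 j)⟩ = j))
    (P₀ P₁ : Subgroup (Gqs L v)) (hP₀ : ∀ g, g ∈ P₀ ↔ a g (A 0) = A 0)
    (hP₁ : ∀ g, g ∈ P₁ ↔ (a g).mapEdgeSet ⟨s(A 0, A (0 + 1)), (SimpleGraph.mem_edgeSet _).2 (latticeGraph_adj_apartmentEnum_succ_of_involution hσ hvσ hϖ A hA0 hA1 0)⟩ =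
      ⟨s(A 0, A (0 + 1)), (SimpleGraph.mem_edgeSet _).2 (latticeGraph_adj_apartmentEnum_succ_of_involution hσ hvσ hϖ A hA0 hA1 0)⟩) :
    (∀ y : Gqs L v, ∃ i : Fin 2, ∃ h : ↥t.P, ∃ κ ∈ P₁,
      y = (h : Gqs L v) * (![(1 : Gqs L v), τM * eA.symm (weylLongU (galAdicCompletionMap (L := L) (IsCMField.complexConj L) hw) rfl)] i) * κ) ∧
    (∀ i j : Fin 2, (∃ h : ↥t.P, ∃ κ ∈ P₁,
      (![(1 : Gqs L v), τM * eA.symm (weylLongU (galAdicCompletionMap (L := L) (IsCMField.complexConj L) hw) rfl)] j) =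
        (h : Gqs L v) * (![(1 : Gqs L v), τM * eA.symm (weylLongU (galAdicCompletionMap (L := L) (IsCMField.complexConj L) hw) rfl)] i) * κ) → i = j) ∧
    (∀ (i : Fin 2) (y : Gqs L v),
      y ∈ t.P ⊓ P₁.map (MulAut.conj (![(1 : Gqs L v), τM * eA.symm (weylLongU (galAdicCompletionMap (L := L) (IsCMField.complexConj L) hw) rfl)] i)).toMonoidHom ↔
        y ∈ t.P ∧ (![(1 : Gqs L v), τM * eA.symm (weylLongU (galAdicCompletionMap (L := L) (IsCMField.complexConj L) hw) rfl)] i)⁻¹ * y *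
          (![(1 : Gqs L v), τM * eA.symm (weylLongU (galAdicCompletionMap (L := L) (IsCMField.complexConj L) hw) rfl)] i) ∈ P₁) ∧
    (∀ (i : Fin 2) (x : ↥(t.P ⊓ P₁.map (MulAut.conj (![(1 : Gqs L v), τM * eA.symm (weylLongU (galAdicCompletionMap (L := L) (IsCMField.complexConj L) hw) rfl)] i)).toMonoidHom)),
      ∃ c ∈ (t.M ⊓ P₀).subgroupOf (t.P ⊓ P₁.map (MulAut.conj (![(1 : Gqs L v), τM * eA.symm (weylLongU (galAdicCompletionMap (L := L) (IsCMField.complexConj L) hw) rfl)] i)).toMonoidHom),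
      ∃ n ∈ t.N.subgroupOf (t.P ⊓ P₁.map (MulAut.conj (![(1 : Gqs L v), τM * eA.symm (weylLongU (galAdicCompletionMap (L := L) (IsCMField.complexConj L) hw) rfl)] i)).toMonoidHom),
      x = c * n) ∧
    (∀ i : Fin 2, IsCompact (((t.M ⊓ P₀).subgroupOf
      (t.P ⊓ P₁.map (MulAut.conj (![(1 : Gqs L v), τM * eA.symm (weylLongU (galAdicCompletionMap (L := L) (IsCMField.complexConj L) hw) rfl)] i)).toMonoidHom) :
        Subgroup ↥(t.P ⊓ P₁.map (MulAut.conj (![(1 : Gqs L v), τM * eA.symm (weylLongU (galAdicCompletionMap (L := L) (IsCMField.complexConj L) hw) rfl)] i)).toMonoidHom)) :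
      Set ↥(t.P ⊓ P₁.map (MulAut.conj (![(1 : Gqs L v), τM * eA.symm (weylLongU (galAdicCompletionMap (L := L) (IsCMField.complexConj L) hw) rfl)] i)).toMonoidHom))) := by
  obtain ⟨nd, nt, hD⟩ := exists_isRamifiedQuadraticDatum_of_placesOver L w hw he ϖ hϖ
  obtain ⟨-, -, -, heven, hd, h1d, h2t⟩ := hD
  exact borelDoubleCoset_edge_of_horocycleIndex L v w hw eA heA ha A hA0 hA1 t ht τM hτM hτA hσ hvσ hϖ heven hd h1d h2t hX1v hX1e P₀ P₁ hP₀ hP₁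

end Iwahori

end Summit.HodgeConjecture.HodgeConjecture.Cruxes.H413.K2E3BorelDoubleCosetsIwahoriAtDatumWild

end
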